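import Summits.Ventures.CertifiedManyBodySolver.Observables.KKTBlindness
import HarnessLib

/-!
# Nesting of the sourced MIXED KKT block in the field on the invariant slice
# (hubbard-cq census (38) / OBSTRUCTIONS-critic-1 v1.7 (4), v1.8.1: «the slice-feasible set SHRINKS as the field grows;
# E_Z(h) is non-decreasing»)

HONEST FRAMING: certificate-GRAMMAR bookkeeping about what a sourced KKT relaxation can see on a `U(1)`-invariant
pseudo-state; nothing here is a number of the Hubbard model, an order parameter or a phase word.

Cell hubbard-cq; companion of `KKTBlindness.lean` (charges, invariant functionals, `secondOrder_entry_of_invariant`,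
`posSemidef_sub_smul_of_le`), `KKTBlindnessFieldIndependence.lean` (pure blocks are field-blind) and
`KKTBlindnessMixedBlock.lean` (the Nambu-mixed block is never blind at a GIVEN field). THIS FILE = critic-1 g3's
`section SliceNesting` (HOME/hubbard-cq-critic-1/KKTBlindness.lean sha16 6e1f2f53dc7f666f): by
`secondOrder_entry_of_invariant` the sourced KKT block of a charge-MIXED generator family evaluated on an invariant
functional has the shape `mixedBlock A B C h = fromBlocks A (−h·B) (−h·Bᴴ) C` — field-independent pure blocks `A`, `C`
on the diagonal, the pair-transfer coupling `B` (from the `D†/D` channels) off it, LINEAR in `h`. Positivity of the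
whole block forces `A ⪰ 0`, `C ⪰ 0` (principal submatrices), hence the block-diagonal part is `⪰ 0` with NO extra
hypothesis, and `posSemidef_sub_smul_of_le` nests the feasible fields downward:

* `mixedBlock_nested` — `(mixedBlock A B C h).PosSemidef → 0 ≤ h' → h' ≤ h → (mixedBlock A B C h').PosSemidef`.

Reading (not a theorem of this file): with first-order rows and pure blocks field-blind (`KKTBlindnessFieldIndependence`)
and the objective field-free on the slice, the slice energy floor `E_Z(h)` of a sourced KKT relaxation is NON-DECREASING
in `h` — flat below the mixed-block onset, rising after it (pilot-2 F1 = kit j263464 at L1: flat to `1e-8` for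
`g ≤ 3/7`, `+0.0039 / +0.0268` at `g = 4/7`; anomaly-1 AUDIT-KKTMIX-F1 §3(iii)); a DEcrease of `E_Z` with the field in
any engine row is therefore a bug (tripwire).

Zero compute; one auxiliary `def` (`mixedBlock`, a `fromBlocks` abbreviation); no named fact; no `sorry`.
References: critic-1 OBSTRUCTIONS v1.8.1 (cell file); R. A. Horn, C. R. Johnson, *Matrix Analysis* (2013),
Observation 7.1.2 (principal submatrices of PSD matrices) [HornJohnson2013].
-/

noncomputable section

namespace Summit.Ventures.CertifiedManyBodySolver.Observables

open Matrix
open scoped ComplexOrder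

namespace KKTBlindness

section SliceNesting

/-! ## Nesting of the sourced mixed-block feasible set in the field (v1.7 (4), v1.8.1)

On the invariant slice the sourced KKT block of a charge-MIXED generator family is
`mixedBlock A B C h = fromBlocks A (−h·B) (−h·Bᴴ) C`: `A`, `C` are the field-independent charge-pure
blocks (`pureBlock_eq_unsourced`) and `B` the pair-transfer coupling produced by the `D†/D` channels
(`secondOrder_entry_of_invariant`). Positivity of the whole block forces `A ⪰ 0` and `C ⪰ 0` (principal
submatrices), hence the block-diagonal part `Q₀ ⪰ 0` WITHOUT any extra hypothesis, and then
`posSemidef_sub_smul_of_le` nests the feasible fields downward: feasible at `h` ⇒ feasible at every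
`h' ∈ [0, h]` (`mixedBlock_nested`). Consequence (the objective being field-free on the slice): the slice
energy floor `E_Z(h)` is NON-DECREASING in `h` — flat below the mixed-block onset `h_b`, rising after it —
which is what pilot-2's F1 (kit j263464) shows at L1 (flat to `1e-8` for `g ≤ 3/7`, `+0.0039 / +0.0268` at
`4/7`; anomaly-1 AUDIT-KKTMIX-F1 §3(iii)). -/

variable {p q : Type*}

/-- The sourced KKT block of a mixed family on the invariant slice: pure blocks `A`, `C` on the
diagonal, pair-transfer coupling `−h·B` off the diagonal. -/
def mixedBlock (A : Matrix p p ℂ) (B : Matrix p q ℂ) (C : Matrix q q ℂ) (h : ℝ) :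
    Matrix (p ⊕ q) (p ⊕ q) ℂ :=
  Matrix.fromBlocks A (-((h : ℂ) • B)) (-((h : ℂ) • Bᴴ)) C

/-- The mixed block is the field-free block-diagonal part minus `h` times the pair-transfer coupling
(linear in the field). -/
theorem mixedBlock_eq_sub (A : Matrix p p ℂ) (B : Matrix p q ℂ) (C : Matrix q q ℂ) (h : ℝ) :
    mixedBlock A B C h
      = Matrix.fromBlocks A 0 0 C - (h : ℂ) • Matrix.fromBlocks 0 B Bᴴ 0 := by
  ext i j
  rcases i with i | i <;> rcases j with j | j <;> simp [mixedBlock]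

/-- Positivity of the mixed block forces positivity of its pure diagonal blocks. -/
theorem pure_posSemidef_of_mixedBlock {A : Matrix p p ℂ} {B : Matrix p q ℂ} {C : Matrix q q ℂ}
    {h : ℝ} (hM : (mixedBlock A B C h).PosSemidef) : A.PosSemidef ∧ C.PosSemidef := by
  constructor
  · have e : (mixedBlock A B C h).submatrix Sum.inl Sum.inl = A := by
      ext i j; simp [mixedBlock]
    simpa [e] using hM.submatrix Sum.inl
  · have e : (mixedBlock A B C h).submatrix Sum.inr Sum.inr = C := by
      ext i j; simp [mixedBlock]
    simpa [e] using hM.submatrix Sum.inr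

variable [Fintype p] [Fintype q]

/-- A block-diagonal matrix with positive semidefinite blocks is positive semidefinite. -/
theorem posSemidef_fromBlocks_diag {A : Matrix p p ℂ} {C : Matrix q q ℂ} (hA : A.PosSemidef)
    (hC : C.PosSemidef) : (Matrix.fromBlocks A 0 0 C).PosSemidef := by
  refine Matrix.PosSemidef.of_dotProduct_mulVec_nonneg
    (Matrix.IsHermitian.fromBlocks hA.1 (by simp) hC.1) fun x => ?_
  have hsx : star x = Sum.elim (star (x ∘ Sum.inl)) (star (x ∘ Sum.inr)) := by
    ext (i | i) <;> simp
  rw [Matrix.fromBlocks_mulVec, hsx, sumElim_dotProduct_sumElim]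
  simp only [Matrix.zero_mulVec, add_zero, zero_add]
  exact add_nonneg (hA.dotProduct_mulVec_nonneg _) (hC.dotProduct_mulVec_nonneg _)

/-- **Nesting (v1.7 (4)).** If the sourced mixed block is positive semidefinite at field `h`, it is
positive semidefinite at every field `h' ∈ [0, h]`: the slice-feasible set SHRINKS as the field grows, so
the slice energy floor `E_Z` is non-decreasing in the field and the feasible fields of a fixed slice
point form an interval containing `0`. No hypothesis `Q₀ ⪰ 0` is needed — it is read off the diagonal. -/
theorem mixedBlock_nested {A : Matrix p p ℂ} {B : Matrix p q ℂ} {C : Matrix q q ℂ} {h h' : ℝ}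
    (hM : (mixedBlock A B C h).PosSemidef) (h0 : 0 ≤ h') (hle : h' ≤ h) :
    (mixedBlock A B C h').PosSemidef := by
  obtain ⟨hA, hC⟩ := pure_posSemidef_of_mixedBlock hM
  have hQ0 := posSemidef_fromBlocks_diag hA hC
  rcases eq_or_lt_of_le h0 with h0' | hpos'
  · subst h0'
    simpa [mixedBlock_eq_sub] using hQ0
  · have hh : 0 < h := lt_of_lt_of_le hpos' hle
    rw [mixedBlock_eq_sub] at hM ⊢
    exact posSemidef_sub_smul_of_le hQ0 hh hM h0 hle

/-- In particular a mixed block feasible at some field `h > 0` is feasible at `h = 0`, i.e. its pure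
blocks are the unsourced KKT blocks and they hold: the field never HELPS feasibility on the slice. -/
theorem mixedBlock_zero_of_pos {A : Matrix p p ℂ} {B : Matrix p q ℂ} {C : Matrix q q ℂ} {h : ℝ}
    (hh : 0 ≤ h) (hM : (mixedBlock A B C h).PosSemidef) : (mixedBlock A B C 0).PosSemidef :=
  mixedBlock_nested hM le_rfl hh

end SliceNesting

end KKTBlindness

end Summit.Ventures.CertifiedManyBodySolver.Observables

end
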